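import Mathlib.Data.Matrix.Mul
import Summits.NavierStokesRegularity.FluidComputer.ChainField
import Literature.Analysis.FluidPDE.FluidComputer.TubeCheck
import HarnessLib

/-!
# The chain field in dyadic interval arithmetic: term table, Jacobian matrix, interval twins and
# the integer quadratic-remainder bound (`pub-fluidc-bp3/R1-DESIGN.md` §9.4, layer B of `structure Row`)

HONEST FRAMING (cell `pub-fluidc`, blueprint seat bp3, gen 20): low prior, high value-of-information
experiment on Tao's machine paradigm; NOT a claim that NS blows up. Algebra about an explicit
9-dimensional quadratic vector field and its interval evaluation; nothing here is about Navier–Stokes.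

The ramp-enclosure kernel (`code/thgate/g19/kgen19.py`) evaluates the toy chain field `ChainField.F g Λ`
through its MONOMIAL TABLE (`chainlib.terms`: component `i` is `Σ_τ ± c_τ X_{j_τ} X_{k_τ}`, `c_τ` one of the
six couplings, downstream terms carrying the factor `Λ`): `F_interval`, `J_interval` (row `i`, for each
term: `row[j] += c·X_k`, `row[k] += c·X_j`) and the integer bound `Fabs_int` (`Σ ⌈|c| EB_j / 2^P⌉ EB_k`,
rounded up). This file is the Lean twin, bit-exact in the order of interval operations:
* `terms : Fin 9 → List Term` (the table), `Fsum`/`Fsum_eq` (the table sums to `ChainField.F`), the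
  Jacobian MATRIX `Jmat` with `Jmat_mulVec : Jmat X *ᵥ E = J X E` and the matrix Taylor split
  `taylor_split_mat` (hypothesis `hF` of `RowModel.Cert` with `Jm t = Jmat (x̂ t)`, `Q = F`);
* interval twins `Term.coefI`, `FI`, `JmatI` over interval coupling tables `cU` (upstream) and `cD`
  (downstream, enclosing `Λ·g`), with soundness `mem_FI`, `mem_JmatI` from `cU.Mem P g`, `cD.Mem P (scaled g Λ)`;
* the integer remainder bound `FabsB` with `abs_F_le_FabsB : |E k| ≤ EB k / 2^P ⇒ |F E i| ≤ FabsB i / 2^P`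
  (hypothesis `hQ` of `RowModel.Cert`).

[cite: Tao2016AveragedNS, §5.5 Thm 5.3 (5.5); §6.1 Remark 6.1]
-/

open Finset BigOperators

namespace Summit.NavierStokesRegularity.FluidComputer

open Literature.Analysis.FluidPDE.FluidComputer
open Literature.Analysis.ValidatedNumerics.Numerics (cdiv div_le_cdiv)

namespace ChainField

/-! ### The monomial table -/

/-- A monomial `± c X_j X_k` of the chain field: `dn` = downstream (coefficient `Λ c`), `c` = which
coupling (`0 … 5` = `ε σ ν μ r κ`), `sgn` = negative sign, indices `j ≤ k`. [folklore] -/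
structure Term where
  /-- downstream term (carries `Λ`) -/
  dn : Bool
  /-- coupling index: `ε σ ν μ r κ` -/
  c : Fin 6
  /-- negative sign -/
  sgn : Bool
  /-- first factor -/
  j : Fin 9
  /-- second factor -/
  k : Fin 9

/-- The monomial table of `ChainField.F` (`chainlib.terms`), component by component. [folklore] -/
def terms : Fin 9 → List Term := ![
  [⟨false, 0, true, 0, 1⟩, ⟨false, 1, true, 0, 2⟩, ⟨false, 3, false, 2, 2⟩, ⟨false, 4, true, 2, 3⟩],
  [⟨false, 0, false, 0, 0⟩, ⟨false, 2, true, 2, 2⟩],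
  [⟨false, 1, false, 0, 0⟩, ⟨false, 2, false, 1, 2⟩, ⟨false, 3, true, 0, 2⟩],
  [⟨false, 4, false, 0, 2⟩, ⟨false, 5, true, 3, 4⟩],
  [⟨false, 5, false, 3, 3⟩, ⟨true, 0, true, 4, 5⟩, ⟨true, 1, true, 4, 6⟩, ⟨true, 3, false, 6, 6⟩,
    ⟨true, 4, true, 6, 7⟩],
  [⟨true, 0, false, 4, 4⟩, ⟨true, 2, true, 6, 6⟩],
  [⟨true, 1, false, 4, 4⟩, ⟨true, 2, false, 5, 6⟩, ⟨true, 3, true, 4, 6⟩],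
  [⟨true, 4, false, 4, 6⟩, ⟨true, 5, true, 7, 8⟩],
  [⟨true, 5, false, 7, 7⟩]]

/-- The six couplings of gate data, by index. [folklore] -/
def gsel (g : GateData) : Fin 6 → ℝ := ![g.ε, g.σ, g.ν, g.μ, g.r, g.κ]

/-- Downstream gate data: every entry times `Λ`. [folklore] -/
def scaled (g : GateData) (Λ : ℝ) : GateData :=
  ⟨Λ * g.ε, Λ * g.σ, Λ * g.ν, Λ * g.μ, Λ * g.r, Λ * g.κ, Λ * g.δ⟩

/-- `gsel (scaled g Λ) c = Λ · gsel g c`. [folklore] -/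
theorem gsel_scaled (g : GateData) (Λ : ℝ) (c : Fin 6) : gsel (scaled g Λ) c = Λ * gsel g c := by
  fin_cases c <;> simp [gsel, scaled]

/-- The real coefficient of a term. [folklore] -/
def Term.coef (g : GateData) (Λ : ℝ) (τ : Term) : ℝ :=
  (if τ.sgn then -1 else 1) * ((if τ.dn then Λ else 1) * gsel g τ.c)

variable (g : GateData) (Λ : ℝ)

/-- The field as the sum over its monomial table. [folklore] -/
noncomputable def Fsum (X : Fin 9 → ℝ) (i : Fin 9) : ℝ :=
  ((terms i).map fun τ => τ.coef g Λ * (X τ.j * X τ.k)).sum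

/-- The table sums to `ChainField.F`. [folklore] -/
theorem Fsum_eq (X : Fin 9 → ℝ) : Fsum g Λ X = F g Λ X := by
  ext i
  fin_cases i <;> simp [Fsum, terms, F, Term.coef, gsel, -mul_eq_mul_left_iff, -mul_eq_mul_right_iff] <;> ring

/-- **The Jacobian matrix** of `F` at `X`, from the table (`J(x)_{i,l} = Σ_τ c [j=l] X_k + c [k=l] X_j`).
[folklore] -/
noncomputable def Jmat (X : Fin 9 → ℝ) : Matrix (Fin 9) (Fin 9) ℝ := fun i l =>
  ((terms i).map fun τ =>
    (if τ.j = l then τ.coef g Λ * X τ.k else 0) + (if τ.k = l then τ.coef g Λ * X τ.j else 0)).sum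

/-- `Jmat X *ᵥ E = J X E`: the matrix represents the Jacobian action of `ChainField.J`. [folklore] -/
theorem Jmat_mulVec (X E : Fin 9 → ℝ) : (Jmat g Λ X).mulVec E = J g Λ X E := by
  ext i
  fin_cases i <;>
    simp [Jmat, terms, J, Term.coef, gsel, Matrix.mulVec, dotProduct, Fin.sum_univ_succ, -mul_eq_mul_left_iff,
      -mul_eq_mul_right_iff] <;> ring

/-- **Matrix Taylor split** (hypothesis `hF` of `RowModel.Cert` with `Jm t = Jmat (x̂ t)`, `Q = F`):
`F (X + v) = F X + Jmat X *ᵥ v + F v`. [folklore] -/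
theorem taylor_split_mat (X v : Fin 9 → ℝ) :
    F g Λ (X + v) = F g Λ X + (Jmat g Λ X).mulVec v + F g Λ v := by
  rw [Jmat_mulVec, taylor_split]

/-! ### Interval twins -/

/-- The six interval couplings, by index. [folklore] -/
def gselI (G : GateDataI) : Fin 6 → DI := ![G.ε, G.σ, G.ν, G.μ, G.r, G.κ]

/-- Soundness of `gselI`. [folklore] -/
theorem mem_gselI {P : ℕ} {G : GateDataI} {g : GateData} (h : G.Mem P g) :
    ∀ c, (gselI G c).mem P (gsel g c) := by
  intro c
  fin_cases c
  · simpa [gselI, gsel] using h.ε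
  · simpa [gselI, gsel] using h.σ
  · simpa [gselI, gsel] using h.ν
  · simpa [gselI, gsel] using h.μ
  · simpa [gselI, gsel] using h.r
  · simpa [gselI, gsel] using h.κ

/-- The interval coefficient of a term over the upstream table `cU` and the downstream table `cD`
(the kernel's `TERMS_I`; `of_frac(−c) = neg (of_frac c)`). [folklore] -/
def Term.coefI (cU cD : GateDataI) (τ : Term) : DI :=
  if τ.sgn then (gselI (if τ.dn then cD else cU) τ.c).neg else gselI (if τ.dn then cD else cU) τ.c

variable {P : ℕ} {cU cD : GateDataI} {g} {Λ}

/-- Soundness of `Term.coefI`. [folklore] -/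
theorem Term.mem_coefI (hU : cU.Mem P g) (hD : cD.Mem P (scaled g Λ)) (τ : Term) :
    (τ.coefI cU cD).mem P (τ.coef g Λ) := by
  rcases τ with ⟨dn, c, sgn, j, k⟩
  have hDc : (gselI cD c).mem P (Λ * gsel g c) := by simpa [gsel_scaled] using mem_gselI hD c
  unfold Term.coefI Term.coef
  cases dn <;> cases sgn
  · simpa using mem_gselI hU c
  · simpa using DI.mem_neg (mem_gselI hU c)
  · simpa using hDc
  · simpa using DI.mem_neg hDc

/-- Generic soundness of a left fold whose step adds an enclosed real increment. [folklore] -/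
theorem mem_foldl_step {α : Type*} {stI : DI → α → DI} {stR : α → ℝ} (l : List α)
    (h : ∀ (acc : DI) (r : ℝ) (a : α), acc.mem P r → (stI acc a).mem P (r + stR a)) :
    ∀ {acc : DI} {r : ℝ}, acc.mem P r → (l.foldl stI acc).mem P (r + (l.map stR).sum) := by
  induction l with
  | nil => intro acc r hacc; simpa using hacc
  | cons a l ih =>
      intro acc r hacc
      have h1 := ih (h acc r a hacc)
      simpa [List.foldl_cons, List.map_cons, List.sum_cons, add_assoc] using h1

variable (P cU cD)

/-- Interval twin of `F` (`F_interval`: `acc ← acc + c·(X_j·X_k)` in table order). [folklore] -/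
def FI (XI : Fin 9 → DI) (i : Fin 9) : DI :=
  (terms i).foldl (fun acc τ => acc.add ((τ.coefI cU cD).mul P ((XI τ.j).mul P (XI τ.k)))) (DI.pt 0)

/-- The row-`l` update of `J_interval` for one term: `row[j] += c·X_k` then `row[k] += c·X_j`. [folklore] -/
def jstepI (XI : Fin 9 → DI) (l : Fin 9) (acc : DI) (τ : Term) : DI :=
  if τ.k = l then
    (if τ.j = l then acc.add ((τ.coefI cU cD).mul P (XI τ.k)) else acc).add ((τ.coefI cU cD).mul P (XI τ.j))
  else (if τ.j = l then acc.add ((τ.coefI cU cD).mul P (XI τ.k)) else acc)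

/-- Interval twin of the Jacobian matrix (`J_interval`). [folklore] -/
def JmatI (XI : Fin 9 → DI) (i l : Fin 9) : DI := (terms i).foldl (jstepI P cU cD XI l) (DI.pt 0)

variable {P cU cD}

/-- **Soundness of `FI`.** [folklore] -/
theorem mem_FI (hU : cU.Mem P g) (hD : cD.Mem P (scaled g Λ)) {XI : Fin 9 → DI} {X : Fin 9 → ℝ}
    (hX : ∀ k, (XI k).mem P (X k)) (i : Fin 9) : (FI P cU cD XI i).mem P (F g Λ X i) := by
  rw [← Fsum_eq]
  have h0 : (DI.pt 0).mem P (0 : ℝ) := by simpa using DI.mem_pt P 0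
  have h := mem_foldl_step (P := P) (terms i)
    (stI := fun acc τ => acc.add ((τ.coefI cU cD).mul P ((XI τ.j).mul P (XI τ.k))))
    (stR := fun τ => τ.coef g Λ * (X τ.j * X τ.k))
    (fun acc r τ hacc => DI.mem_add hacc
      (DI.mem_mul (Term.mem_coefI hU hD τ) (DI.mem_mul (hX τ.j) (hX τ.k)))) h0
  simpa [FI, Fsum] using h

/-- Soundness of the one-term Jacobian update. [folklore] -/
theorem mem_jstepI (hU : cU.Mem P g) (hD : cD.Mem P (scaled g Λ)) {XI : Fin 9 → DI} {X : Fin 9 → ℝ}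
    (hX : ∀ k, (XI k).mem P (X k)) (l : Fin 9) (acc : DI) (r : ℝ) (τ : Term) (hacc : acc.mem P r) :
    (jstepI P cU cD XI l acc τ).mem P
      (r + ((if τ.j = l then τ.coef g Λ * X τ.k else 0) + (if τ.k = l then τ.coef g Λ * X τ.j else 0))) := by
  have hc := Term.mem_coefI hU hD τ
  have hk' := DI.mem_mul hc (hX τ.k)
  have hj' := DI.mem_mul hc (hX τ.j)
  unfold jstepI
  split_ifs <;>
    first
    | simpa [add_assoc] using DI.mem_add (DI.mem_add hacc hk') hj'
    | simpa using DI.mem_add hacc hj'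
    | simpa using DI.mem_add hacc hk'
    | simpa using hacc

/-- **Soundness of `JmatI`** against `Jmat`. [folklore] -/
theorem mem_JmatI (hU : cU.Mem P g) (hD : cD.Mem P (scaled g Λ)) {XI : Fin 9 → DI} {X : Fin 9 → ℝ}
    (hX : ∀ k, (XI k).mem P (X k)) (i l : Fin 9) : (JmatI P cU cD XI i l).mem P (Jmat g Λ X i l) := by
  have h0 : (DI.pt 0).mem P (0 : ℝ) := by simpa using DI.mem_pt P 0
  have h := mem_foldl_step (P := P) (terms i) (stI := jstepI P cU cD XI l)
    (stR := fun τ => (if τ.j = l then τ.coef g Λ * X τ.k else 0) + (if τ.k = l then τ.coef g Λ * X τ.j else 0))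
    (fun acc r τ hacc => mem_jstepI hU hD hX l acc r τ hacc) h0
  simpa [JmatI, Jmat] using h

/-! ### The integer quadratic-remainder bound -/

variable (P cU cD)

/-- `Fabs_int`: `⌈(Σ_τ ⌈|c_τ| EB_j / 2^P⌉ · EB_k) / 2^P⌉` with `|c_τ| ≤ mag (coefI τ)`. [folklore] -/
def FabsB (EB : Fin 9 → ℤ) (i : Fin 9) : ℤ :=
  cdiv ((terms i).foldl (fun s τ => s + cdiv ((τ.coefI cU cD).mag * EB τ.j) (2 ^ P) * EB τ.k) 0) (2 ^ P)

variable {P cU cD}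

/-- One term of the remainder bound. [folklore] -/
theorem abs_term_le (hU : cU.Mem P g) (hD : cD.Mem P (scaled g Λ)) {E : Fin 9 → ℝ} {EB : Fin 9 → ℤ}
    (hE : ∀ k, |E k| ≤ (EB k : ℝ) / 2 ^ P) (τ : Term) :
    |τ.coef g Λ * (E τ.j * E τ.k)|
      ≤ ((cdiv ((τ.coefI cU cD).mag * EB τ.j) (2 ^ P) * EB τ.k : ℤ) : ℝ) / 2 ^ P / 2 ^ P := by
  have h2 : (0 : ℝ) < 2 ^ P := by positivity
  have hc : |τ.coef g Λ| ≤ ((τ.coefI cU cD).mag : ℝ) / 2 ^ P := DI.abs_le_mag (Term.mem_coefI hU hD τ)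
  have hEB : ∀ k, (0 : ℝ) ≤ EB k := fun k => by
    by_contra hneg
    rw [not_le] at hneg
    have : (EB k : ℝ) / 2 ^ P < 0 := div_neg_of_neg_of_pos hneg h2
    linarith [abs_nonneg (E k), hE k]
  have hmag : (0 : ℝ) ≤ (τ.coefI cU cD).mag := by exact_mod_cast DI.mag_nonneg _
  -- |c| |Ej| |Ek| ≤ (mag/2^P) (EBj/2^P) (EBk/2^P)
  have h1 : |τ.coef g Λ * (E τ.j * E τ.k)|
      ≤ ((τ.coefI cU cD).mag : ℝ) / 2 ^ P * ((EB τ.j : ℝ) / 2 ^ P) * ((EB τ.k : ℝ) / 2 ^ P) := by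
    rw [abs_mul, abs_mul]
    have ha := mul_le_mul hc (hE τ.j) (abs_nonneg _) (div_nonneg hmag h2.le)
    calc |τ.coef g Λ| * (|E τ.j| * |E τ.k|) = |τ.coef g Λ| * |E τ.j| * |E τ.k| := by ring
      _ ≤ ((τ.coefI cU cD).mag : ℝ) / 2 ^ P * ((EB τ.j : ℝ) / 2 ^ P) * ((EB τ.k : ℝ) / 2 ^ P) :=
          mul_le_mul ha (hE τ.k) (abs_nonneg _)
            (mul_nonneg (div_nonneg hmag h2.le) (div_nonneg (hEB τ.j) h2.le))
  -- (mag EBj)/2^P ≤ cdiv (mag EBj) 2^P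
  have hcd : ((τ.coefI cU cD).mag : ℝ) * (EB τ.j : ℝ) / 2 ^ P
      ≤ ((cdiv ((τ.coefI cU cD).mag * EB τ.j) (2 ^ P) : ℤ) : ℝ) := by
    have := div_le_cdiv (a := (τ.coefI cU cD).mag * EB τ.j) (b := 2 ^ P) (by positivity)
    simpa [Int.cast_mul, Int.cast_pow] using this
  calc |τ.coef g Λ * (E τ.j * E τ.k)|
      ≤ ((τ.coefI cU cD).mag : ℝ) / 2 ^ P * ((EB τ.j : ℝ) / 2 ^ P) * ((EB τ.k : ℝ) / 2 ^ P) := h1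
    _ = ((τ.coefI cU cD).mag : ℝ) * (EB τ.j : ℝ) / 2 ^ P * (EB τ.k : ℝ) / 2 ^ P / 2 ^ P := by ring
    _ ≤ ((cdiv ((τ.coefI cU cD).mag * EB τ.j) (2 ^ P) : ℤ) : ℝ) * (EB τ.k : ℝ) / 2 ^ P / 2 ^ P := by
        gcongr
        exact hEB τ.k
    _ = ((cdiv ((τ.coefI cU cD).mag * EB τ.j) (2 ^ P) * EB τ.k : ℤ) : ℝ) / 2 ^ P / 2 ^ P := by
        push_cast; ring

/-- The integer fold is the sum of the per-term integers. [folklore] -/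
theorem foldl_add_eq_sum {α : Type*} (l : List α) (f : α → ℤ) (s : ℤ) :
    l.foldl (fun s a => s + f a) s = s + (l.map f).sum := by
  induction l generalizing s with
  | nil => simp
  | cons a l ih => simp [List.foldl_cons, ih, add_assoc]

/-- **Soundness of `FabsB`** (hypothesis `hQ` of `RowModel.Cert` with `Q = F`, `FQ = FabsB / 2^P`,
`Ē = EB / 2^P`): `|E k| ≤ EB k / 2^P` for all `k` implies `|F E i| ≤ FabsB EB i / 2^P`. [folklore] -/
theorem abs_F_le_FabsB (hU : cU.Mem P g) (hD : cD.Mem P (scaled g Λ)) {E : Fin 9 → ℝ}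
    {EB : Fin 9 → ℤ} (hE : ∀ k, |E k| ≤ (EB k : ℝ) / 2 ^ P) (i : Fin 9) :
    |F g Λ E i| ≤ (FabsB P cU cD EB i : ℝ) / 2 ^ P := by
  have h2 : (0 : ℝ) < 2 ^ P := by positivity
  rw [← Fsum_eq]
  set tI : Term → ℤ := fun τ => cdiv ((τ.coefI cU cD).mag * EB τ.j) (2 ^ P) * EB τ.k with htI
  -- |Fsum| ≤ Σ |terms| ≤ Σ tI / 2^P / 2^P
  have hsum : |Fsum g Λ E i| ≤ ((((terms i).map tI).sum : ℤ) : ℝ) / 2 ^ P / 2 ^ P := by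
    have key : ∀ l : List Term, |(l.map (fun τ => τ.coef g Λ * (E τ.j * E τ.k))).sum|
        ≤ (((l.map tI).sum : ℤ) : ℝ) / 2 ^ P / 2 ^ P := by
      intro l
      induction l with
      | nil => simp
      | cons τ l ih =>
          simp only [List.map_cons, List.sum_cons, Int.cast_add, add_div]
          exact (abs_add_le _ _).trans (add_le_add (abs_term_le hU hD hE τ) ih)
    exact key (terms i)
  -- Σ tI / 2^P ≤ cdiv (Σ tI) 2^P
  have hcd : ((((terms i).map tI).sum : ℤ) : ℝ) / 2 ^ P ≤ ((cdiv ((terms i).map tI).sum (2 ^ P) : ℤ) : ℝ) := by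
    have := div_le_cdiv (a := ((terms i).map tI).sum) (b := 2 ^ P) (by positivity)
    simpa [Int.cast_pow] using this
  have hfold : (terms i).foldl (fun s τ => s + cdiv ((τ.coefI cU cD).mag * EB τ.j) (2 ^ P) * EB τ.k) 0
      = ((terms i).map tI).sum := by
    rw [foldl_add_eq_sum, zero_add]
  unfold FabsB
  rw [hfold]
  exact hsum.trans (div_le_div_of_nonneg_right hcd h2.le)

end ChainField

end Summit.NavierStokesRegularity.FluidComputer
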